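import Mathlib.Tactic.Ring
import Mathlib.Tactic.NormNum
import Summits.CriticalPhenomena.PercolationContinuityZ3.Theorems.PercNearOneGluingNoHeavyLowerTailSahiCTCHarrisBlock
import Summits.CriticalPhenomena.PercolationContinuityZ3.Theorems.PercNearOneGluingNoHeavyLowerTailSahiCTCDownLYM
import Summits.CriticalPhenomena.PercolationContinuityZ3.Theorems.PercNearOneGluingNoHeavyLowerTailSahiCTCVertexAtoms
import HarnessLib

/-!
# `NoHeavyLowerTail` (crux stmt-CriticalPhenomena-4575), P3 lane: the Harris and LYM BLOCKS relative to a ground finset `V ⊆ univ` and in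
# status-rectangle form, plus the coefficientwise-nonnegativity closure helpers `cw_*`

Support file (seat `prim-l12-p3`, gen 19; `--supports stmt-CriticalPhenomena-4575`).  Memo `run/shared/lean/prim/prim-l12/FROM-prim-l12-p3-g19-CERTIFICATE-ROAD-G011.md`;
memo g9 (`…-g9-COEFFICIENTWISE-THRESHOLD-CERTIFICATE.md`) §7 for the inductive certificate framework.  Nothing is asserted about the crux.

The companion files `…SahiCTCHarrisBlock` / `…SahiCTCDownLYM` prove the blocks of g9 §7.3 over the whole type (`univ`).  The vertex induction runs
over shrinking ground finsets `V`, so the blocks are transported to `V` by the support argument (`coeff_univ_filter_mul_gf_eq`: at a profile supported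
in `V` the colour-blind `univ` families may be replaced by their `V` versions; `coeff_gf_mul_gf_eq_zero_of_not_subset` otherwise):
* `coeff_harrisV_sub_nonneg` (`Π_V·GF(F∩G) − GF(F)·GF(G) ∈ ℕ[r]` for down-sets `F,G ⊆ 2^V`), `coeff_downLYMV_sub_nonneg`, the level-CLASS form
  `coeff_lymClassV_sub_nonneg` (`LYM[F; {lo..1} < {≥2}]`), and the status-rectangle forms `coeff_harrisRect_sub_nonneg`, `coeff_lymRectStat_sub_nonneg`
  used verbatim by the certificate files;
* `cw_add/mul/zero/one/natCast/ofNat/X/Xpow/atom`: closure of 'all coefficients ≥ 0'.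
-/

namespace Summit.CriticalPhenomena.PercolationContinuityZ3.Theorems.SahiCTCForms

open Finset MvPolynomial SahiCTCGenFun SahiCTCWeightedLYM

variable {α : Type*} [DecidableEq α]

/-! ### Blocks relative to a ground finset `V ⊆ univ` (from the `univ` blocks of the companion files) -/

section groundblocks
variable [Fintype α]

omit [Fintype α] in
/-- If both families live inside `V` and the profile `n` does not, the product coefficient vanishes. [this work] -/
theorem coeff_gf_mul_gf_eq_zero_of_not_subset {F G : Finset (Finset α)} {V : Finset α} (hF : ∀ S ∈ F, S ⊆ V)
    (hG : ∀ S ∈ G, S ⊆ V) {n : α →₀ ℕ} (hn : ¬ n.support ⊆ V) : (gf F * gf G).coeff n = 0 := by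
  rw [coeff_gf_mul_gf]
  have : ((F ×ˢ G).filter fun PS => ind PS.1 + ind PS.2 = n) = ∅ := by
    refine filter_eq_empty_iff.2 fun PS hPS h => hn ?_
    obtain ⟨hP, hS⟩ := mem_product.1 hPS
    rw [← ((ind_add_ind_eq_iff _ _ _).1 h).2.2]
    exact union_subset (hF _ hP) (hG _ hS)
  rw [this, card_empty]; rfl

/-- For a profile supported in `V`, the colour-blind `univ` families may be replaced by their `V` versions. [this work] -/
theorem coeff_univ_filter_mul_gf_eq {q : Finset α → Prop} [DecidablePred q] {G : Finset (Finset α)} {V : Finset α}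
    {n : α →₀ ℕ} (hn : n.support ⊆ V) :
    (gf (univ.powerset.filter q) * gf G).coeff n = (gf (V.powerset.filter q) * gf G).coeff n := by
  rw [coeff_gf_mul_gf, coeff_gf_mul_gf]
  congr 1
  refine congrArg _ ?_
  ext PS
  simp only [mem_filter, mem_product, mem_powerset]
  constructor
  · rintro ⟨⟨⟨_, hq⟩, hS⟩, h⟩
    refine ⟨⟨⟨?_, hq⟩, hS⟩, h⟩
    rw [← ((ind_add_ind_eq_iff _ _ _).1 h).2.2] at hn
    exact subset_union_left.trans hn
  · rintro ⟨⟨⟨_, hq⟩, hS⟩, h⟩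
    exact ⟨⟨⟨subset_univ _, hq⟩, hS⟩, h⟩

/-- **Harris block relative to a ground set**: for down-sets `F, G ⊆ 2^V`, `Π_V·GF(F∩G) − GF(F)·GF(G) ∈ ℕ[r]`. [this work] -/
theorem coeff_harrisV_sub_nonneg {V : Finset α} {F G : Finset (Finset α)} (hF : IsLowerSet (F : Set (Finset α)))
    (hG : IsLowerSet (G : Set (Finset α))) (hFV : ∀ S ∈ F, S ⊆ V) (hGV : ∀ S ∈ G, S ⊆ V) (n : α →₀ ℕ) :
    0 ≤ (gf V.powerset * gf (F ∩ G) - gf F * gf G).coeff n := by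
  rw [coeff_sub, sub_nonneg]
  by_cases hn : n.support ⊆ V
  · have h := coeff_harris hF hG n
    unfold PiP at h
    have e : (gf (univ.powerset : Finset (Finset α)) * gf (F ∩ G)).coeff n = (gf V.powerset * gf (F ∩ G)).coeff n := by
      have := coeff_univ_filter_mul_gf_eq (q := fun _ => True) (G := F ∩ G) hn
      simpa only [filter_true] using this
    rw [← e]; exact h
  · rw [coeff_gf_mul_gf_eq_zero_of_not_subset hFV hGV hn]
    exact coeff_mul_nonneg (coeff_gf_nonneg _) (coeff_gf_nonneg _) n

/-- **LYM block relative to a ground set** (single levels `c ≤ j`): for a down-set `K ⊆ 2^V`, `e_j^V·GF(K_c) − e_c^V·GF(K_j) ∈ ℕ[r]`. [this work] -/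
theorem coeff_downLYMV_sub_nonneg {V : Finset α} {K : Finset (Finset α)} (hK : IsLowerSet (K : Set (Finset α)))
    (hKV : ∀ S ∈ K, S ⊆ V) {c j : ℕ} (hcj : c ≤ j) (n : α →₀ ℕ) :
    0 ≤ (gf (V.powerset.filter fun P => #P = j) * gf (K.filter fun S => #S = c) -
      gf (V.powerset.filter fun P => #P = c) * gf (K.filter fun S => #S = j)).coeff n := by
  rw [coeff_sub, sub_nonneg]
  have hKc : ∀ S ∈ K.filter (fun S => #S = c), S ⊆ V := fun S hS => hKV S (mem_filter.1 hS).1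
  have hKj : ∀ S ∈ K.filter (fun S => #S = j), S ⊆ V := fun S hS => hKV S (mem_filter.1 hS).1
  by_cases hn : n.support ⊆ V
  · rw [← coeff_univ_filter_mul_gf_eq (q := fun P => #P = c) hn, ← coeff_univ_filter_mul_gf_eq (q := fun P => #P = j) hn]
    exact coeff_downLYM hK hcj n
  · have hVc : ∀ S ∈ V.powerset.filter (fun P => #P = c), S ⊆ V := fun S hS => mem_powerset.1 (mem_filter.1 hS).1
    rw [coeff_gf_mul_gf_eq_zero_of_not_subset hVc hKj hn]
    exact coeff_mul_nonneg (coeff_gf_nonneg _) (coeff_gf_nonneg _) n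

omit [Fintype α] in
/-- A family inside `2^V`, graded by size: `GF{S ∈ F : q #S} = Σ_{k ≤ #V, q k} GF(F_k)`. [this work] -/
theorem gf_filter_card_eq_sum {V : Finset α} {F : Finset (Finset α)} (hF : ∀ S ∈ F, S ⊆ V) (q : ℕ → Prop) [DecidablePred q] :
    gf (F.filter fun S => q #S) = ∑ k ∈ (range (#V + 1)).filter q, gf (F.filter fun S => #S = k) := by
  unfold gf
  rw [← sum_biUnion]
  · congr 1; ext S
    simp only [mem_biUnion, mem_filter, mem_range]
    constructor
    · rintro ⟨hS, hq⟩
      exact ⟨#S, ⟨Nat.lt_succ_of_le (card_le_card (hF S hS)), hq⟩, hS, rfl⟩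
    · rintro ⟨k, ⟨_, hq⟩, hS, rfl⟩; exact ⟨hS, hq⟩
  · intro k _ l _ hkl
    exact disjoint_left.2 fun S h1 h2 => hkl ((mem_filter.1 h1).2.symm.trans (mem_filter.1 h2).2)

/-- **The LYM block with level CLASSES** (g9 §7.3 `LYM[F; I<J]` with `I = {lo ≤ · ≤ 1}`, `J = {≥ 2}`): for a down-set `K ⊆ 2^V`,
`e^V_{≥2}·GF(K_{lo..1}) − e^V_{lo..1}·GF(K_{≥2}) ∈ ℕ[r]`. [this work] -/
theorem coeff_lymClassV_sub_nonneg {V : Finset α} {K : Finset (Finset α)} (hK : IsLowerSet (K : Set (Finset α)))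
    (hKV : ∀ S ∈ K, S ⊆ V) (lo : ℕ) (n : α →₀ ℕ) :
    0 ≤ (gf (V.powerset.filter fun P => 2 ≤ #P) * gf (K.filter fun S => lo ≤ #S ∧ #S ≤ 1) -
      gf (V.powerset.filter fun P => lo ≤ #P ∧ #P ≤ 1) * gf (K.filter fun S => 2 ≤ #S)).coeff n := by
  have hVV : ∀ S ∈ V.powerset, S ⊆ V := fun S hS => mem_powerset.1 hS
  have e1 : gf (V.powerset.filter fun P => 2 ≤ #P) = ∑ j ∈ (range (#V + 1)).filter (fun j => 2 ≤ j), gf (V.powerset.filter fun P => #P = j) :=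
    gf_filter_card_eq_sum hVV (fun j => 2 ≤ j)
  have e2 : gf (K.filter fun S => lo ≤ #S ∧ #S ≤ 1) = ∑ c ∈ (range (#V + 1)).filter (fun c => lo ≤ c ∧ c ≤ 1), gf (K.filter fun S => #S = c) :=
    gf_filter_card_eq_sum hKV (fun c => lo ≤ c ∧ c ≤ 1)
  have e3 : gf (V.powerset.filter fun P => lo ≤ #P ∧ #P ≤ 1) = ∑ c ∈ (range (#V + 1)).filter (fun c => lo ≤ c ∧ c ≤ 1), gf (V.powerset.filter fun P => #P = c) :=
    gf_filter_card_eq_sum hVV (fun c => lo ≤ c ∧ c ≤ 1)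
  have e4 : gf (K.filter fun S => 2 ≤ #S) = ∑ j ∈ (range (#V + 1)).filter (fun j => 2 ≤ j), gf (K.filter fun S => #S = j) :=
    gf_filter_card_eq_sum hKV (fun j => 2 ≤ j)
  rw [e1, e2, e3, e4, sum_mul_sum, sum_mul_sum, sum_comm (s := (range (#V + 1)).filter (fun c => lo ≤ c ∧ c ≤ 1)), ← sum_sub_distrib,
    coeff_sum]
  refine sum_nonneg fun j hj => ?_
  rw [← sum_sub_distrib, coeff_sum]
  refine sum_nonneg fun c hc => ?_
  have hj2 := (mem_filter.1 hj).2
  have hc1 := (mem_filter.1 hc).2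
  exact coeff_downLYMV_sub_nonneg hK hKV (show c ≤ j by omega) n

end groundblocks

/-! ### Coefficientwise-nonnegativity closure helpers -/

section cw
omit [DecidableEq α] in
/-- Sums preserve coefficientwise nonnegativity. [this work] -/
theorem cw_add {P Q : MvPolynomial α ℤ} (hP : ∀ m, 0 ≤ P.coeff m) (hQ : ∀ m, 0 ≤ Q.coeff m) : ∀ m, 0 ≤ (P + Q).coeff m :=
  fun m => by rw [coeff_add]; exact add_nonneg (hP m) (hQ m)
/-- Products preserve coefficientwise nonnegativity. [this work] -/
theorem cw_mul {P Q : MvPolynomial α ℤ} (hP : ∀ m, 0 ≤ P.coeff m) (hQ : ∀ m, 0 ≤ Q.coeff m) : ∀ m, 0 ≤ (P * Q).coeff m :=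
  coeff_mul_nonneg hP hQ
omit [DecidableEq α] in
/-- `0` is coefficientwise nonnegative. [this work] -/
theorem cw_zero : ∀ m, 0 ≤ (0 : MvPolynomial α ℤ).coeff m := fun m => by rw [coeff_zero]
/-- Natural-number constants are coefficientwise nonnegative. [this work] -/
theorem cw_natCast (k : ℕ) : ∀ m, 0 ≤ (k : MvPolynomial α ℤ).coeff m := by
  intro m
  rw [← map_natCast (C : ℤ →+* MvPolynomial α ℤ) k, coeff_C]
  split_ifs
  · exact Int.natCast_nonneg k
  · exact le_rfl
/-- Natural multiples preserve coefficientwise nonnegativity. [this work] -/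
theorem cw_natMul (k : ℕ) {P : MvPolynomial α ℤ} (hP : ∀ m, 0 ≤ P.coeff m) : ∀ m, 0 ≤ ((k : MvPolynomial α ℤ) * P).coeff m :=
  cw_mul (cw_natCast k) hP
/-- A variable is coefficientwise nonnegative. [this work] -/
theorem cw_X (v : α) : ∀ m, 0 ≤ (X v : MvPolynomial α ℤ).coeff m := by
  intro m; rw [show (X v : MvPolynomial α ℤ) = monomial (Finsupp.single v 1) 1 from rfl, coeff_monomial]; split_ifs <;> decide
/-- Atoms are coefficientwise nonnegative. [this work] -/
theorem cw_atom (V' : Finset α) (KX KZ : Finset (Finset α)) (v : α) (a b L : ℕ) :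
    ∀ m, 0 ≤ (atom V' KX KZ v a b L).coeff m := coeff_atom_nonneg V' KX KZ v a b L
end cw

section cwpow
/-- `1` is coefficientwise nonnegative. [this work] -/
theorem cw_one : ∀ m, 0 ≤ (1 : MvPolynomial α ℤ).coeff m := by
  intro m; rw [coeff_one]; split_ifs <;> decide
/-- Numerals are coefficientwise nonnegative. [this work] -/
theorem cw_ofNat (k : ℕ) [k.AtLeastTwo] : ∀ m, 0 ≤ (OfNat.ofNat k : MvPolynomial α ℤ).coeff m :=
  fun m => cw_natCast (α := α) k m
/-- Powers of a variable are coefficientwise nonnegative. [this work] -/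
theorem cw_Xpow (v : α) (k : ℕ) : ∀ m, 0 ≤ (X v ^ k : MvPolynomial α ℤ).coeff m := by
  intro m; rw [X_pow_eq_monomial, coeff_monomial]; split_ifs <;> decide
end cwpow

/-! ### Down-rectangles and the blocks in status-family form -/

section rectblocks
variable [Fintype α] {V' : Finset α} {KX KZ : Finset (Finset α)} {v : α}

omit [Fintype α] in
/-- A status rectangle `{a ≤ xa, b ≤ xb, L ≤ xl}` is a down-set (for down-sets `KX, KZ`). [this work] -/
theorem isLowerSet_statFam_rect (hKX : IsLowerSet (KX : Set (Finset α))) (hKZ : IsLowerSet (KZ : Set (Finset α))) (xa xb xl : ℕ) :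
    IsLowerSet ((statFam V' KX KZ v (fun a b L => a ≤ xa ∧ b ≤ xb ∧ L ≤ xl) : Finset (Finset α)) : Set (Finset α)) :=
  isLowerSet_statFam hKX hKZ fun a b L a' b' L' ha hb hL h => by omega

/-- **Harris block on two down-rectangles.** [this work] -/
theorem coeff_harrisRect_sub_nonneg (hKX : IsLowerSet (KX : Set (Finset α))) (hKZ : IsLowerSet (KZ : Set (Finset α)))
    (xa xb xl ya yb yl : ℕ) (n : α →₀ ℕ) :
    0 ≤ (gf V'.powerset * gf (statFam V' KX KZ v (fun a b L => a ≤ xa ∧ b ≤ xb ∧ L ≤ xl) ∩ statFam V' KX KZ v (fun a b L => a ≤ ya ∧ b ≤ yb ∧ L ≤ yl))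
      - gf (statFam V' KX KZ v (fun a b L => a ≤ xa ∧ b ≤ xb ∧ L ≤ xl)) * gf (statFam V' KX KZ v (fun a b L => a ≤ ya ∧ b ≤ yb ∧ L ≤ yl))).coeff n :=
  coeff_harrisV_sub_nonneg (isLowerSet_statFam_rect hKX hKZ xa xb xl) (isLowerSet_statFam_rect hKX hKZ ya yb yl)
    (fun _ h => subset_of_mem_statFam h) (fun _ h => subset_of_mem_statFam h) n

/-- **LYM class block on a down-rectangle.** [this work] -/
theorem coeff_lymRect_sub_nonneg (hKX : IsLowerSet (KX : Set (Finset α))) (hKZ : IsLowerSet (KZ : Set (Finset α)))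
    (xa xb lo : ℕ) (n : α →₀ ℕ) :
    0 ≤ (gf (V'.powerset.filter fun P => 2 ≤ #P) * gf ((statFam V' KX KZ v (fun a b L => a ≤ xa ∧ b ≤ xb ∧ L ≤ 3)).filter fun S => lo ≤ #S ∧ #S ≤ 1)
      - gf (V'.powerset.filter fun P => lo ≤ #P ∧ #P ≤ 1) * gf ((statFam V' KX KZ v (fun a b L => a ≤ xa ∧ b ≤ xb ∧ L ≤ 3)).filter fun S => 2 ≤ #S)).coeff n :=
  coeff_lymClassV_sub_nonneg (isLowerSet_statFam_rect hKX hKZ xa xb 3) (fun _ h => subset_of_mem_statFam h) lo n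

omit [Fintype α] in
/-- level filters of a status family. [this work] -/
theorem statFam_filter_lo1 (P : ℕ → ℕ → ℕ → Prop) [∀ a b L, Decidable (P a b L)] (lo : ℕ) :
    (statFam V' KX KZ v P).filter (fun S => lo ≤ #S ∧ #S ≤ 1) = statFam V' KX KZ v (fun a b L => P a b L ∧ (lo ≤ L ∧ L ≤ 1)) :=
  statFam_filter_card P (fun k => lo ≤ k ∧ k ≤ 1) (fun L => lo ≤ L ∧ L ≤ 1) fun S => by unfold lvl; omega
omit [Fintype α] in
/-- Level filter `≥ 2` of a status family. [this work] -/
theorem statFam_filter_ge2 (P : ℕ → ℕ → ℕ → Prop) [∀ a b L, Decidable (P a b L)] :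
    (statFam V' KX KZ v P).filter (fun S => 2 ≤ #S) = statFam V' KX KZ v (fun a b L => P a b L ∧ 2 ≤ L) :=
  statFam_filter_card P (fun k => 2 ≤ k) (fun L => 2 ≤ L) fun S => by rw [two_le_lvl_iff]

end rectblocks

end Summit.CriticalPhenomena.PercolationContinuityZ3.Theorems.SahiCTCForms
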